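import Literature.AnabelianGeometry.AbsoluteAnabelian.AbsTopI.SemiAbsoluteChainsSmall
import HarnessLib

/-!
# [AbsTopI] Theorem 4.7 (i)/(iii) as typed — the model-relative schemata `SchemeChains.Thm_4_7_i`,
# `SchemeChains.Thm_4_7_iii` and their `𝒟`-hypothesised forms `Thm_4_7_i_of`, `Thm_4_7_iii_of`,
# `Thm_4_7_i_ofMem`, `Thm_4_7_iii_ofMem` HEAD-MATCHED AT THE SMALL-SKELETON DATUM — PROOF-ONLY

S. Mochizuki, *Topics in Absolute Anabelian Geometry I: Generalities*, J. Math. Sci. Univ. Tokyo **19** (2012)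
139–242, Thm 4.7 (i) p. 57 "the natural functors `Chain(X̃ᵢ/Xᵢ) → Chain(Πᵢ)`, `Chain^{iso-trm}(X̃ᵢ/Xᵢ) →
Chain^{iso-trm}(Πᵢ)`, `ÉtLoc(X̃ᵢ/Xᵢ) → ÉtLoc(Πᵢ)` are equivalences of categories that are compatible with passing
to type-chains", (iii) p. 57 "Suppose further that the rel-hom-DGC holds, and that `Xᵢ` is a hyperbolic orbicurve.
Then the natural functors `Chain^{trm}(X̃ᵢ/Xᵢ) → Chain^{trm}(Πᵢ)`, `DLoc(X̃ᵢ/Xᵢ) → DLoc(Πᵢ)` are equivalences"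
[cite: MochizukiAbsTopI2012, Thm 4.7 (i) p.57] [cite: MochizukiAbsTopI2012, Thm 4.7 (iii) p.57].

PROOF-ONLY companion of `AbsTopI/SemiAbsoluteChains.lean` / `AbsTopI/SemiAbsoluteChainsHyp.lean` (cell abc-iut,
block F, seat abc-iut-f-020, KEY INST59A; FROZEN FACT-LIST rows F-0202 `SchemeChains.Thm_4_7_iii`, F-0204
`Thm_4_7_i_of`, F-0205 `Thm_4_7_iii_of`, F-2662 `Thm_4_7_iii_ofMem`, with F-0200 `SchemeChains.Thm_4_7_i` and F-2661
`Thm_4_7_i_ofMem` alongside; 0 `def`, 0 `instance`, 0 `structure`; nothing restated).  All six are SCHEMATA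
over a FREE scheme-side interface `S : SchemeChains E C hP hΔ hne` (shape (M): "the `X̃/X`-chains of one member
with the natural functor of Rmk 4.2.1 to `Π`-chains"; no instance in the tree, FOUNDATIONS row 12).  Their
universal closures are false (abc-iut-f-058/f-059: `SemiAbsoluteChainsSchema`, `SemiAbsoluteChainsHypSchemaNegative`)
and the positive evidence of record is the ∃-PACKAGE `SchemeChains.exists_thm_4_7_i_and_iii` of
`SemiAbsoluteChainsSmall.lean` (abc-iut-f-058: `Chain(Π)` is essentially `u`-small, so its small skeleton
`g : ι → Chain(Π)` with isomorphisms / terminal (iso)morphisms pulled back along `g` is a scheme-chain datum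
satisfying (i) ∧ (iii) at EVERY parameter) — so no theorem of the tree has one of the six schemata as its
conclusion HEAD.  This file names that datum by `Exists.choose` and states each schema FOR IT, every remaining
binder (`E`, `C`, `hP`, `hΔ`, `hne`, the class `𝒟`, its member `X` over `k_b`) universally quantified, and
records the conditional closers reducing the four `𝒟`-hypothesised forms to the bare (M)-forms (the class-level
hypotheses — chain-fullness, rel-isom-DGC / rel-hom-DGC, membership, hyperbolicity — are simply not used).

HONEST LABEL (as in `SemiAbsoluteChainsSmall.lean`): at the skeleton datum the scheme side `Chain(X̃/X)` is
MODELLED by the group-theoretic side; these are consistency / satisfiability statements about OUR typed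
predicates, not Thm 4.7 for a hyperbolic orbicurve, whose scheme side is not in the tree.  Nothing here bears on
[IUTchIII] Cor. 3.12 or takes a side on any author; typed ≠ proved for anything not in this file.
-/

noncomputable section

open CategoryTheory Topology

universe u

namespace Literature.AnabelianGeometry.AbsoluteAnabelian.AbsTopI

open Literature.AlgebraicGeometry.Frobenioids (IsSlimGroup)
open FundamentalExtension

/-! ### The bare (M)-forms at the small-skeleton datum (rows F-0200, F-0202) -/

section Skeleton

variable {E : FundamentalExtension.{u}} (C : CuspidalData E) (hP : IsSlimGroup E.arith)
  (hΔ : IsSlimGroup E.geom) (hne : E.geom ≠ ⊥)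

/-- **F-0200 / [AbsTopI] Thm 4.7 (i) as typed, AT THE SMALL-SKELETON DATUM**: for every extension `E` with
`Π`, `Δ` slim and `Δ ≠ 1` and every cuspidal data `C`, the scheme-chain datum of
`SchemeChains.exists_thm_4_7_i_and_iii` (named by `Exists.choose`: the small skeleton of `Chain(Π)`, morphism
predicates pulled back) satisfies `SchemeChains.Thm_4_7_i` — essentially surjective on `Chain(Π)`, full on
isomorphisms and on terminal isomorphisms. [cite: MochizukiAbsTopI2012, Thm 4.7 (i) p.57] -/
theorem SchemeChains.thm_4_7_i_skeleton :
    SchemeChains.Thm_4_7_i (SchemeChains.exists_thm_4_7_i_and_iii C hP hΔ hne).choose :=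
  (SchemeChains.exists_thm_4_7_i_and_iii C hP hΔ hne).choose_spec.1

/-- **F-0202 / [AbsTopI] Thm 4.7 (iii) as typed, AT THE SMALL-SKELETON DATUM**: the same datum satisfies
`SchemeChains.Thm_4_7_iii` — full on terminal morphisms (`Chain^{trm}`). [cite: MochizukiAbsTopI2012, Thm 4.7 (iii) p.57] -/
theorem SchemeChains.thm_4_7_iii_skeleton :
    SchemeChains.Thm_4_7_iii (SchemeChains.exists_thm_4_7_i_and_iii C hP hΔ hne).choose :=
  (SchemeChains.exists_thm_4_7_i_and_iii C hP hΔ hne).choose_spec.2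

end Skeleton

/-! ### The `𝒟`-hypothesised forms from the bare forms (conditional closers; rows F-0204, F-0205, F-2661, F-2662) -/

section OfBare

variable (𝒟 : ConstructionDataClass.{u})

/-- **F-0204 from F-0200**: a scheme-chain datum satisfying Thm 4.7 (i) as typed satisfies the
`𝒟`-hypothesised form `Thm_4_7_i_of 𝒟 S` for EVERY class `𝒟` (its hypotheses "𝒟 chain-full, rel-isom-DGC" are
not used; cf. audit R3-N1: in the unlinked form `𝒟` is idle). [cite: MochizukiAbsTopI2012, Thm 4.7 (i) p.57] -/
theorem thm_4_7_i_of_of_thm_4_7_i {E : FundamentalExtension.{u}} {C : CuspidalData E}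
    {hP : IsSlimGroup E.arith} {hΔ : IsSlimGroup E.geom} {hne : E.geom ≠ ⊥} {S : SchemeChains E C hP hΔ hne}
    (h : S.Thm_4_7_i) : Thm_4_7_i_of 𝒟 S :=
  fun _ _ => h

/-- **F-0205 from F-0200 ∧ F-0202**: a scheme-chain datum satisfying Thm 4.7 (i) and (iii) as typed satisfies
`Thm_4_7_iii_of 𝒟 S` for EVERY class `𝒟`. [cite: MochizukiAbsTopI2012, Thm 4.7 (iii) p.57] -/
theorem thm_4_7_iii_of_of_thm_4_7_i_of_thm_4_7_iii {E : FundamentalExtension.{u}} {C : CuspidalData E}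
    {hP : IsSlimGroup E.arith} {hΔ : IsSlimGroup E.geom} {hne : E.geom ≠ ⊥} {S : SchemeChains E C hP hΔ hne}
    (h : S.Thm_4_7_i) (h' : S.Thm_4_7_iii) : Thm_4_7_iii_of 𝒟 S :=
  fun _ _ => ⟨h, h'⟩

variable (b : 𝒟.Base) (X : (𝒟.datum b).Obj)

/-- **F-2661 from F-0200** (linked form): for a member `X` of `𝒟` over `k_b` and a scheme-chain datum `S` for ITS
extension `(𝒟.datum b).ext X` satisfying Thm 4.7 (i) as typed, `Thm_4_7_i_ofMem 𝒟 b X S` holds.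
[cite: MochizukiAbsTopI2012, Thm 4.7 (i) p.57] -/
theorem thm_4_7_i_ofMem_of_thm_4_7_i {C : CuspidalData ((𝒟.datum b).ext X)}
    {hP : IsSlimGroup ((𝒟.datum b).ext X).arith} {hΔ : IsSlimGroup ((𝒟.datum b).ext X).geom}
    {hne : ((𝒟.datum b).ext X).geom ≠ ⊥} {S : SchemeChains ((𝒟.datum b).ext X) C hP hΔ hne}
    (h : S.Thm_4_7_i) : Thm_4_7_i_ofMem 𝒟 b X S :=
  fun _ _ _ => h

/-- **F-2662 from F-0200 ∧ F-0202** (linked form): for a member `X` of `𝒟` over `k_b` and a scheme-chain datum `S`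
for its extension satisfying Thm 4.7 (i) and (iii) as typed, `Thm_4_7_iii_ofMem 𝒟 b X S` holds (membership,
hyperbolicity, chain-fullness and the rel-hom-DGC are not used). [cite: MochizukiAbsTopI2012, Thm 4.7 (iii) p.57] -/
theorem thm_4_7_iii_ofMem_of_thm_4_7_i_of_thm_4_7_iii {C : CuspidalData ((𝒟.datum b).ext X)}
    {hP : IsSlimGroup ((𝒟.datum b).ext X).arith} {hΔ : IsSlimGroup ((𝒟.datum b).ext X).geom}
    {hne : ((𝒟.datum b).ext X).geom ≠ ⊥} {S : SchemeChains ((𝒟.datum b).ext X) C hP hΔ hne}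
    (h : S.Thm_4_7_i) (h' : S.Thm_4_7_iii) : Thm_4_7_iii_ofMem 𝒟 b X S :=
  fun _ _ _ _ => ⟨h, h'⟩

end OfBare

/-! ### The `𝒟`-hypothesised forms at the small-skeleton datum (unconditional instances) -/

section SkeletonOf

variable (𝒟 : ConstructionDataClass.{u})

/-- **F-0204 / [AbsTopI] Thm 4.7 (i) with its printed class-level hypotheses, AT THE SMALL-SKELETON DATUM**:
for every class `𝒟`, every extension `E` (slimness inputs) and cuspidal data `C`, `Thm_4_7_i_of 𝒟 S` holds at
the datum `S` of `SchemeChains.exists_thm_4_7_i_and_iii`. [cite: MochizukiAbsTopI2012, Thm 4.7 (i) p.57] -/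
theorem thm_4_7_i_of_skeleton {E : FundamentalExtension.{u}} (C : CuspidalData E) (hP : IsSlimGroup E.arith)
    (hΔ : IsSlimGroup E.geom) (hne : E.geom ≠ ⊥) :
    Thm_4_7_i_of 𝒟 (SchemeChains.exists_thm_4_7_i_and_iii C hP hΔ hne).choose :=
  thm_4_7_i_of_of_thm_4_7_i 𝒟 (SchemeChains.thm_4_7_i_skeleton C hP hΔ hne)

/-- **F-0205 / [AbsTopI] Thm 4.7 (iii) with its printed class-level hypotheses, AT THE SMALL-SKELETON DATUM**:
for every class `𝒟` and every parameter, `Thm_4_7_iii_of 𝒟 S` holds at the datum `S` of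
`SchemeChains.exists_thm_4_7_i_and_iii`. [cite: MochizukiAbsTopI2012, Thm 4.7 (iii) p.57] -/
theorem thm_4_7_iii_of_skeleton {E : FundamentalExtension.{u}} (C : CuspidalData E) (hP : IsSlimGroup E.arith)
    (hΔ : IsSlimGroup E.geom) (hne : E.geom ≠ ⊥) :
    Thm_4_7_iii_of 𝒟 (SchemeChains.exists_thm_4_7_i_and_iii C hP hΔ hne).choose :=
  thm_4_7_iii_of_of_thm_4_7_i_of_thm_4_7_iii 𝒟 (SchemeChains.thm_4_7_i_skeleton C hP hΔ hne)
    (SchemeChains.thm_4_7_iii_skeleton C hP hΔ hne)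

variable (b : 𝒟.Base) (X : (𝒟.datum b).Obj) (C : CuspidalData ((𝒟.datum b).ext X))
  (hP : IsSlimGroup ((𝒟.datum b).ext X).arith) (hΔ : IsSlimGroup ((𝒟.datum b).ext X).geom)
  (hne : ((𝒟.datum b).ext X).geom ≠ ⊥)

/-- **F-2661 / [AbsTopI] Thm 4.7 (i), linked form, AT THE SMALL-SKELETON DATUM** of the member's extension
`(𝒟.datum b).ext X`: `Thm_4_7_i_ofMem 𝒟 b X S` holds there, for every class, member and parameter.
[cite: MochizukiAbsTopI2012, Thm 4.7 (i) p.57] -/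
theorem thm_4_7_i_ofMem_skeleton :
    Thm_4_7_i_ofMem 𝒟 b X (SchemeChains.exists_thm_4_7_i_and_iii C hP hΔ hne).choose :=
  thm_4_7_i_ofMem_of_thm_4_7_i 𝒟 b X (SchemeChains.thm_4_7_i_skeleton C hP hΔ hne)

/-- **F-2662 / [AbsTopI] Thm 4.7 (iii), linked form, AT THE SMALL-SKELETON DATUM** of the member's extension:
`Thm_4_7_iii_ofMem 𝒟 b X S` holds there, for every class, member and parameter.
[cite: MochizukiAbsTopI2012, Thm 4.7 (iii) p.57] -/
theorem thm_4_7_iii_ofMem_skeleton :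
    Thm_4_7_iii_ofMem 𝒟 b X (SchemeChains.exists_thm_4_7_i_and_iii C hP hΔ hne).choose :=
  thm_4_7_iii_ofMem_of_thm_4_7_i_of_thm_4_7_iii 𝒟 b X (SchemeChains.thm_4_7_i_skeleton C hP hΔ hne)
    (SchemeChains.thm_4_7_iii_skeleton C hP hΔ hne)

end SkeletonOf

end Literature.AnabelianGeometry.AbsoluteAnabelian.AbsTopI
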